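import Literature.NumberTheory.EllipticCurves.CuspFormHorizontalPeriod
import Literature.NumberTheory.EllipticCurves.PeterssonFdCoordinatesProofs
import HarnessLib

/-!
# Strip integrals `∫_{0 ≤ Re w < h} ψ(w) g(Im w) dμ(w)` vanish for periodic cusp-type `ψ`

[[cite: Shintani1975, §2, proof of Prop. 2.3 (p. 103)]] — the NULL-orbit contribution in the
unfolding of Shintani's theta lift: after moving the double root of a non-zero null lattice vector
to `∞`, the stabiliser acts by `w ↦ w + h`, a fundamental domain is the strip `0 ≤ Re w < h`, and
the kernel term depends on `Im w` only, so the orbit integral is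
`∫₀^∞ g(v) v⁻² (∫₀ʰ ψ(u + iv) du) dv = 0` for the translate `ψ = φ|σ` of the cusp form.  We PROVE,
for any `ψ : ℍ → ℂ` holomorphic, `h`-periodic and tending to `0` at `i∞`, and any profile `g`:

* `hstrip h = {0 ≤ Re w < h}` (measurable), `image_coe_hstrip`;
* **`setIntegral_hstrip_mul_eq_zero`** — `∫_{hstrip h} ψ(w) g(Im w) dμ(w) = 0` whenever the
  integrand is integrable: transport to `ℂ` (tree `FdCoord.setIntegral_eq_setIntegral_image`,
  `dμ = du dv/v²`), to `ℝ × ℝ` (`Complex.measurableEquivRealProd`), Fubini with the height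
  outermost, and `horizontalPeriod_eq_zero` (`CuspFormHorizontalPeriod`).

No named facts; the only definition is `hstrip`.
-/

noncomputable section

open scoped Manifold Topology
open UpperHalfPlane hiding I
open Complex Filter MeasureTheory Set

namespace Literature.NumberTheory.EllipticCurves.ModularForms

/-- The vertical strip `0 ≤ Re w < h` in `ℍ` (a fundamental domain of `w ↦ w + h`). [folklore] -/
def hstrip (h : ℝ) : Set ℍ := {w : ℍ | 0 ≤ (w : ℂ).re ∧ (w : ℂ).re < h}

/-- The strip is measurable. [folklore] -/
theorem measurableSet_hstrip (h : ℝ) : MeasurableSet (hstrip h) := by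
  have hc : Continuous fun w : ℍ ↦ (w : ℂ).re := Complex.continuous_re.comp continuous_coe
  exact (isClosed_le continuous_const hc).measurableSet.inter (isOpen_lt hc continuous_const).measurableSet

/-- The image of the strip in `ℂ`. [folklore] -/
theorem image_coe_hstrip (h : ℝ) :
    ((↑) : ℍ → ℂ) '' hstrip h = {z : ℂ | 0 < z.im ∧ 0 ≤ z.re ∧ z.re < h} := by
  ext z
  constructor
  · rintro ⟨w, hw, rfl⟩
    exact ⟨w.im_pos, hw.1, hw.2⟩
  · rintro ⟨hz, h1, h2⟩
    exact ⟨⟨z, hz⟩, ⟨h1, h2⟩, rfl⟩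

/-- **Vanishing of strip integrals**: for `ψ` holomorphic on `ℍ`, `h`-periodic (`h > 0`) and
tending to `0` at `i∞`, and any profile `g` of the height, if `ψ(w) g(Im w)` is integrable on the
strip `0 ≤ Re w < h` then `∫_{strip} ψ(w) g(Im w) dμ(w) = 0` — Fubini in the coordinates
`w = u + iv` (`dμ = du dv/v²`) and the vanishing of the horizontal periods `∫₀ʰ ψ(u + iv) du`
(`horizontalPeriod_eq_zero`).  This is the NULL-orbit vanishing in Shintani's unfolding (the
stabiliser of a non-zero null vector is unipotent; "since `φ` is a cusp form, the above integral
is zero"). [cite: Shintani1975, §2, proof of Prop. 2.3 (p. 103)] -/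
theorem setIntegral_hstrip_mul_eq_zero (ψ : ℍ → ℂ) (hψ : MDifferentiable 𝓘(ℂ) 𝓘(ℂ) ψ) {h : ℝ}
    (hh : 0 < h) (hper : ∀ z : ℍ, ψ ((h : ℝ) +ᵥ z) = ψ z) (h0 : IsZeroAtImInfty ψ) (g : ℝ → ℂ)
    (hint : IntegrableOn (fun w : ℍ ↦ ψ w * g w.im) (hstrip h)) :
    ∫ w in hstrip h, ψ w * g w.im = 0 := by
  -- to the coordinates of `ℂ`
  rw [FdCoord.setIntegral_eq_setIntegral_image _ (measurableSet_hstrip h)]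
  have hint' := (FdCoord.integrableOn_image_iff (fun w : ℍ ↦ ψ w * g w.im) (measurableSet_hstrip h)).mpr hint
  rw [image_coe_hstrip] at hint' ⊢
  set A : Set ℂ := {z : ℂ | 0 < z.im ∧ 0 ≤ z.re ∧ z.re < h} with hA
  set G : ℂ → ℂ := fun w ↦ ((1 / w.im ^ 2 : ℝ) : ℂ) * (ψ (UpperHalfPlane.ofComplex w) * g (UpperHalfPlane.ofComplex w).im)
    with hG
  change ∫ w in A, G w = 0
  have hintG : IntegrableOn G A := hint'
  -- to `ℝ × ℝ`
  set e := Complex.measurableEquivRealProd with he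
  have hsymm : MeasurePreserving e.symm volume volume := Complex.volume_preserving_equiv_real_prod.symm e
  have hAmeas : MeasurableSet A := by
    have : A = ((↑) : ℍ → ℂ) '' hstrip h := (image_coe_hstrip h).symm
    rw [this]
    exact UpperHalfPlane.measurableEmbedding_coe.measurableSet_image.mpr (measurableSet_hstrip h)
  have h1 := hsymm.setIntegral_preimage_emb e.symm.measurableEmbedding G A
  rw [← h1]
  have hB : e.symm ⁻¹' A = Ico (0 : ℝ) h ×ˢ Ioi (0 : ℝ) := by
    ext p
    rw [mem_preimage, hA, he, Complex.measurableEquivRealProd_symm_apply, mem_prod, mem_Ico, mem_Ioi]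
    simp only [mem_setOf_eq]
    tauto
  rw [hB]
  have hHint : IntegrableOn (fun p : ℝ × ℝ ↦ G (e.symm p)) (Ico (0 : ℝ) h ×ˢ Ioi (0 : ℝ)) := by
    rw [← hB]; exact (hsymm.integrableOn_comp_preimage e.symm.measurableEmbedding).mpr hintG
  have hesymm : ∀ p : ℝ × ℝ, e.symm p = (p.1 : ℂ) + p.2 * I := by
    intro p
    rw [he, Complex.measurableEquivRealProd_symm_apply, Complex.mk_eq_add_mul_I]
  -- Fubini, the height `v` outermost
  have hvol : (volume : Measure (ℝ × ℝ)).restrict (Ico (0 : ℝ) h ×ˢ Ioi (0 : ℝ)) =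
      (volume.restrict (Ico (0 : ℝ) h)).prod (volume.restrict (Ioi (0 : ℝ))) := by
    rw [Measure.prod_restrict, ← Measure.volume_eq_prod]
  have hHint2 : Integrable (fun p : ℝ × ℝ ↦ G (e.symm p))
      ((volume.restrict (Ico (0 : ℝ) h)).prod (volume.restrict (Ioi (0 : ℝ)))) := by
    rw [← hvol]; exact hHint
  change ∫ p in Ico (0 : ℝ) h ×ˢ Ioi (0 : ℝ), G (e.symm p) = 0
  rw [hvol, integral_prod_symm _ hHint2]
  refine integral_eq_zero_of_ae ((ae_restrict_iff' measurableSet_Ioi).mpr (Eventually.of_forall fun v hv ↦ ?_))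
  have hv : 0 < v := hv
  -- the inner integral is `v⁻² g(v) · (horizontal period) = 0`
  have hinner : ∀ u : ℝ, G (e.symm (u, v)) =
      (((1 / v ^ 2 : ℝ) : ℂ) * g v) * (ψ ∘ UpperHalfPlane.ofComplex) ((u : ℂ) + (v : ℂ) * I) := by
    intro u
    have him : ((u : ℂ) + (v : ℂ) * I).im = v := by simp
    have himpos : 0 < ((u : ℂ) + (v : ℂ) * I).im := by rw [him]; exact hv
    rw [hesymm, hG]
    simp only [Function.comp_apply]
    rw [UpperHalfPlane.ofComplex_apply_of_im_pos himpos]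
    simp only [him, UpperHalfPlane.im]
    ring
  simp only [Pi.zero_apply]
  simp_rw [hinner]
  rw [integral_const_mul]
  have hP := horizontalPeriod_eq_zero ψ hψ hh.le hper h0 hv
  rw [horizontalPeriod, intervalIntegral.integral_of_le hh.le, integral_Ioc_eq_integral_Ioo,
    ← integral_Ico_eq_integral_Ioo] at hP
  rw [hP, mul_zero]

end Literature.NumberTheory.EllipticCurves.ModularForms
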